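/-
Copyright: the b2b-balaban cell (near-miss cell 7), T⁴-continuum fan-out, NE7b formalisation swarm, leaf prover 05
(generation 2).  Released under the licence of the surrounding project.
-/
import Summits.QuantumFields.BalabanUV.T4Continuum.Support.HistoryJoinsBudget
import Summits.QuantumFields.BalabanUV.T4Continuum.Support.HistoryZoneMassTotal

/-!
# Row S6g′, binding part 9: the radius-factor total `MρP ≤ exp(κρ·F)` from the extent law summed over the joins

Summits-side support leaf of the T⁴-continuum cell (rung (B)+1 on a FINITE torus only; NOT infinite volume, NOT the
mass gap, NOT the Clay statement; NOT a proof of the spine estimate NE7b).  [folklore] elementary real arithmetic and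
tree bookkeeping over the swarm's OWN carrier (`Gen ε`, `HistoryJoins*`, `HistoryZoneMass*`); nothing is quoted from
print and nothing printed is asserted; no `[cite:]` tag.

WHY.  Part 8's END `HistoryJoinsEnd.card_S_le_exp_pow` displays three class-linear inputs on part 6's functionals; the
second one, `MρP st ext Mρ G ≤ exp(κρ·F)` (the product over all joins of the radius factors `Mρ (ext t P)` of the
non-host parts), had no supplier.  This file supplies it:
* §1 `MρP_le_exp_sum_joins` — for a radius factor of exponential type, `0 ≤ Mρ r ≤ exp(a + d·r)` (`a, d ≥ 0`; e.g.
  `(2r+3)^4 ≤ 81·e^{8r∕3}`), and nonnegative extents, `MρP ≤ exp(Σ_{X ∈ joins} Σ_{P ∈ tparts X} (a + d·ext (ftime X) P))`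
  (host parts thrown in, their factors being `≥ 1`) — the same junction currency (`joins`∕`tparts`∕`ftime` of
  `HistoryZoneMassJoins`) as part 6's `MS_eq_sum_joins`;
* §2 `MρP_le_exp_of_law` — with the extent law DISPLAYED at the joins, `ext (ftime X) P ≤ C₀·φ (ftime X) P + c₀` for
  `X ∈ joins st G`, `P ∈ tparts st X`, and a total `Σ_X Σ_P φ ≤ Φ`: `MρP ≤ exp((a + d·c₀)·2·nmerges G + d·C₀·Φ)`;
* §3 `MρP_le_exp_of_zmass` — the potential taken to be row (a)'s decayed formation mass `zmass` (the currency of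
  `HistoryZoneMassLaw`∕`…Total`), whose total over (join, part) is leaf-02 gen 3's
  `HistoryZoneMassTotal.sum_joins_tparts_zmass_le` (`≤ umass G ∕ (1 − θ)` for a chronological, strictly dated tree), and
  `MρP_le_exp_bsum` — the consumer's shape `MρP ≤ exp(κρ·Σ_births (fat + 1))` with
  `κρ = 2(a + d·c₀) + d·C₀·(WB + WM)∕(1 − θ)`.
WHAT REMAINS DISPLAYED: the extent law at the joins in `zmass` currency (the affine contraction law of
`ZoneExtentLaw.ext_le_affine` is in `qZ` currency; `qZ ≤ zmass` under weight domination is the reader's one-line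
comparison), `Chrono`, `Dated`, and the exponential type of `Mρ`.
HONEST DEPENDENCY (cell): continuum YM on T⁴ ⇐ BetaPertH ∧ nine spine estimates (0/9 proved); BetaPertH ⇐ (D1) ∧ (D4)
∧ CAP+tail.  This file changes none of it.
-/

open Finset
open Literature.MathematicalPhysics.QuantumFieldTheory.Balaban1983to89
open T4PersistenceDictionary T4PartnerMultiplicity T4BranchingRecordsGas
open Summit.QuantumFields.BalabanUV.T4Continuum.HistoryJoins
open Summit.QuantumFields.BalabanUV.T4Continuum.HistoryJoinsAdm
open Summit.QuantumFields.BalabanUV.T4Continuum.HistoryJoinsTotal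
open Summit.QuantumFields.BalabanUV.T4Continuum.HistoryJoinsBudget
open Summit.QuantumFields.BalabanUV.T4Continuum.ZoneTorus
open Summit.QuantumFields.BalabanUV.T4Continuum.ZoneSkeleton
open Summit.QuantumFields.BalabanUV.T4Continuum.HistoryZoneMassJoins
open Summit.QuantumFields.BalabanUV.T4Continuum.HistoryZoneMassLaw
open Summit.QuantumFields.BalabanUV.T4Continuum.HistoryZoneMassTotal

namespace Summit.QuantumFields.BalabanUV.T4Continuum.HistoryJoinsRadius

noncomputable section
open scoped Classical

variable {ε : Type*} (st : ε → ℕ) (ext : ℕ → Gen ε → ℝ) (Mρ : ℝ → ℝ)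

/-! ## §1 `MρP` against the sum over the joins of the parts' log-radius factors -/

/-- a list sum as a sum over its indices [folklore] -/
private theorem sum_map_eq_sum_get'' {α N : Type*} [AddCommMonoid N] (l : List α) (g : α → N) :
    (l.map g).sum = ∑ i : Fin l.length, g (l.get i) := by
  induction l with
  | nil => simp
  | cons a l ih =>
      rw [List.map_cons, List.sum_cons, ih]
      show g a + ∑ i : Fin l.length, g (l.get i) = ∑ i : Fin (l.length + 1), g ((a :: l).get i)
      rw [Fin.sum_univ_succ]
      rfl

/-- the sum over the part indices of a function of the part is the sum over `tparts` [folklore] -/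
theorem sum_part_eq_sum_tparts (G : Gen ε) (g : Gen ε → ℝ) :
    ∑ i : Fin (npart st G), g (part st G i).2 = ((tparts st G).map g).sum := by
  rw [← sum_jparts_eq_sum_tparts st g G, sum_map_eq_sum_get'']
  rfl

/-- dropping the host: for factors bounded by quantities `≥ 1`, the product over the non-host parts is at most the
product of the bounds over all parts [folklore] -/
theorem prod_nonhost_le_prod {n : ℕ} (h : Fin n) {f g : Fin n → ℝ} (hf0 : ∀ i, 0 ≤ f i) (hfg : ∀ i, f i ≤ g i)
    (hg1 : 1 ≤ g h) : ∏ i : {i // i ≠ h}, f i.1 ≤ ∏ i, g i := by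
  rw [prod_eq_host_mul h g]
  have h1 : ∏ i : {i // i ≠ h}, f i.1 ≤ ∏ i : {i // i ≠ h}, g i.1 :=
    prod_le_prod (fun i _ => hf0 i.1) fun i _ => hfg i.1
  have h2 : 0 ≤ ∏ i : {i // i ≠ h}, g i.1 := prod_nonneg fun i _ => (hf0 i.1).trans (hfg i.1)
  nlinarith

/-- **`MρP ≤ exp(Σ_{X ∈ joins} Σ_{P ∈ tparts X} (a + d·ext (ftime X) P))`** for a radius factor of exponential type
`0 ≤ Mρ r ≤ exp(a + d·r)` (`a, d ≥ 0`) and nonnegative extents. [folklore] -/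
theorem MρP_le_exp_sum_joins {a d : ℝ} (ha : 0 ≤ a) (hd : 0 ≤ d) (hMρ0 : ∀ r, 0 ≤ Mρ r)
    (hMρ : ∀ r, 0 ≤ r → Mρ r ≤ Real.exp (a + d * r)) (hext0 : ∀ t P, 0 ≤ ext t P) :
    ∀ G : Gen ε, MρP st ext Mρ G ≤
      Real.exp (((joins st G).map fun X => ((tparts st X).map fun P => a + d * ext (ftime st X) P).sum).sum)
  | Gen.born b j => by simp [MρP, joins, croots, crootsP]
  | Gen.renew G e h => by
      rw [MρP]
      have ih := MρP_le_exp_sum_joins ha hd hMρ0 hMρ hext0 G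
      simpa [joins, croots, crootsP] using ih
  | Gen.merge X Y e => by
      have ih : ∀ i : Fin (npart st (Gen.merge X Y e)), MρP st ext Mρ (part st _ i).2 ≤
          Real.exp (((joins st (part st _ i).2).map fun X' =>
            ((tparts st X').map fun P => a + d * ext (ftime st X') P).sum).sum) :=
        fun i => MρP_le_exp_sum_joins ha hd hMρ0 hMρ hext0 (part st _ i).2
      rw [MρP, sum_joins_merge, Real.exp_add]
      refine mul_le_mul ?_ ?_ (prod_nonneg fun i _ => MρP_nonneg st ext Mρ hMρ0 _) (Real.exp_pos _).le
      · -- the join's own non-host radius factors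
        have step : ∏ i : {i // i ≠ hostIdx st X Y e}, Mρ (ext (st e) (part st (Gen.merge X Y e) i.1).2) ≤
            ∏ i : Fin (npart st (Gen.merge X Y e)), Real.exp (a + d * ext (st e) (part st (Gen.merge X Y e) i).2) :=
          prod_nonhost_le_prod (hostIdx st X Y e) (f := fun i => Mρ (ext (st e) (part st (Gen.merge X Y e) i).2))
            (g := fun i => Real.exp (a + d * ext (st e) (part st (Gen.merge X Y e) i).2))
            (fun i => hMρ0 _) (fun i => hMρ _ (hext0 _ _))
            (Real.one_le_exp (by nlinarith [hext0 (st e) (part st (Gen.merge X Y e) (hostIdx st X Y e)).2]))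
        refine step.trans (le_of_eq ?_)
        rw [← Real.exp_sum, sum_part_eq_sum_tparts st (Gen.merge X Y e) fun P => a + d * ext (st e) P]
        rfl
      · -- the parts' products, by induction
        calc ∏ i : Fin (npart st (Gen.merge X Y e)), MρP st ext Mρ (part st _ i).2
            ≤ ∏ i : Fin (npart st (Gen.merge X Y e)), Real.exp (((joins st (part st _ i).2).map fun X' =>
                ((tparts st X').map fun P => a + d * ext (ftime st X') P).sum).sum) :=
              prod_le_prod (fun i _ => MρP_nonneg st ext Mρ hMρ0 _) fun i _ => ih i
          _ = _ := by
              rw [← Real.exp_sum, sum_part_eq_sum_tparts st (Gen.merge X Y e) fun Q =>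
                ((joins st Q).map fun X' => ((tparts st X').map fun P => a + d * ext (ftime st X') P).sum).sum]
termination_by G => gsize G
decreasing_by
  · simp [gsize]
  · exact gsize_lt_of_mem_jparts st _ _ (part_mem st _ i)

/-! ## §2 The extent law displayed at the joins, with an abstract potential -/

/-- splitting the double list sum of an affine function [folklore] -/
theorem sum_joins_affine (G : Gen ε) (a d C₀ c₀ : ℝ) (φ : ℕ → Gen ε → ℝ) :
    ((joins st G).map fun X => ((tparts st X).map fun P => a + d * (C₀ * φ (ftime st X) P + c₀)).sum).sum =
      (a + d * c₀) * (((joins st G).map fun X => (tparts st X).length).sum : ℝ) +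
        d * C₀ * ((joins st G).map fun X => ((tparts st X).map fun P => φ (ftime st X) P).sum).sum := by
  induction joins st G with
  | nil => simp
  | cons X l ih =>
      simp only [List.map_cons, List.sum_cons, Nat.cast_add]
      rw [ih]
      have h1 : ((tparts st X).map fun P => a + d * (C₀ * φ (ftime st X) P + c₀)).sum =
          (a + d * c₀) * ((tparts st X).length : ℝ) + d * C₀ * ((tparts st X).map fun P => φ (ftime st X) P).sum := by
        induction tparts st X with
        | nil => simp
        | cons P m ihm =>
            simp only [List.map_cons, List.sum_cons, List.length_cons, Nat.cast_add, Nat.cast_one]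
            rw [ihm]; ring
      rw [h1]; ring

/-- **`MρP` UNDER THE DISPLAYED EXTENT LAW**: if at every join `X ∈ joins st G` every part `P ∈ tparts st X` has
`ext (ftime X) P ≤ C₀·φ (ftime X) P + c₀` (`C₀, c₀ ≥ 0`) and the potential's total over (join, part) is at most `Φ`, then
`MρP ≤ exp((a + d·c₀)·2·nmerges G + d·C₀·Φ)`. [folklore] -/
theorem MρP_le_exp_of_law {a d : ℝ} (ha : 0 ≤ a) (hd : 0 ≤ d) (hMρ0 : ∀ r, 0 ≤ Mρ r)
    (hMρ : ∀ r, 0 ≤ r → Mρ r ≤ Real.exp (a + d * r)) (hext0 : ∀ t P, 0 ≤ ext t P)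
    {C₀ c₀ : ℝ} (hC₀ : 0 ≤ C₀) (hc₀ : 0 ≤ c₀) (φ : ℕ → Gen ε → ℝ) (G : Gen ε)
    (hlaw : ∀ X ∈ joins st G, ∀ P ∈ tparts st X, ext (ftime st X) P ≤ C₀ * φ (ftime st X) P + c₀) {Φ : ℝ}
    (hΦ : ((joins st G).map fun X => ((tparts st X).map fun P => φ (ftime st X) P).sum).sum ≤ Φ) :
    MρP st ext Mρ G ≤ Real.exp ((a + d * c₀) * (2 * nmerges G) + d * C₀ * Φ) := by
  refine (MρP_le_exp_sum_joins st ext Mρ ha hd hMρ0 hMρ hext0 G).trans (Real.exp_le_exp.2 ?_)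
  -- pointwise: `a + d·ext ≤ a + d·(C₀ φ + c₀)` at the joins
  have h1 : ((joins st G).map fun X => ((tparts st X).map fun P => a + d * ext (ftime st X) P).sum).sum ≤
      ((joins st G).map fun X => ((tparts st X).map fun P => a + d * (C₀ * φ (ftime st X) P + c₀)).sum).sum :=
    List.sum_le_sum fun X hX => List.sum_le_sum fun P hP => by
      have := hlaw X hX P hP
      nlinarith
  refine h1.trans ?_
  rw [sum_joins_affine]
  have hcount : (((joins st G).map fun X => (tparts st X).length).sum : ℝ) ≤ 2 * (nmerges G : ℝ) := by
    exact_mod_cast sum_length_tparts_le st G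
  have hac : 0 ≤ a + d * c₀ := by positivity
  have hdC : 0 ≤ d * C₀ := by positivity
  nlinarith [mul_le_mul_of_nonneg_left hcount hac, mul_le_mul_of_nonneg_left hΦ hdC]

/-! ## §3 The potential taken to be row (a)'s decayed formation mass -/

/-- `bsum` is linear in the weight [folklore] -/
theorem bsum_mul (c : ℝ) (f : ε → ℝ) : ∀ G : Gen ε, bsum (fun b => c * f b) G = c * bsum f G
  | Gen.born b _ => by simp [bsum]
  | Gen.renew Y _ _ => bsum_mul c f Y
  | Gen.merge Y Z _ => by simp only [bsum, bsum_mul c f Y, bsum_mul c f Z]; ring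

/-- the merge-node count is below the multiplicity-correct birth sum of `fat + 1` [folklore] -/
theorem nmerges_lt_bsum (sh : ε → PEv) : ∀ G : Gen ε, (nmerges G : ℝ) + 1 ≤ bsum (fun b => (((sh b).fat : ℕ) : ℝ) + 1) G
  | Gen.born b _ => by
      simp only [nmerges, bsum, Nat.cast_zero, zero_add]
      have : (0 : ℝ) ≤ (((sh b).fat : ℕ) : ℝ) := Nat.cast_nonneg _
      linarith
  | Gen.renew Y _ _ => by rw [nmerges_renew]; exact nmerges_lt_bsum sh Y
  | Gen.merge Y Z _ => by
      rw [nmerges_merge]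
      simp only [bsum, Nat.cast_add, Nat.cast_one]
      linarith [nmerges_lt_bsum sh Y, nmerges_lt_bsum sh Z]

variable [DecidableEq ε] (sh : ε → PEv)

/-- **`MρP` FROM THE EXTENT LAW IN `zmass` CURRENCY**: for a chronological, strictly dated shape tree, with the law
`ext (ftime X) P ≤ C₀·zmass θ WB WM (ftime X) P + c₀` displayed at the joins,
`MρP ≤ exp((a + d·c₀)·2·nmerges G + d·C₀·umass G∕(1−θ))`. [folklore] -/
theorem MρP_le_exp_of_zmass {a d : ℝ} (ha : 0 ≤ a) (hd : 0 ≤ d) (hMρ0 : ∀ r, 0 ≤ Mρ r)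
    (hMρ : ∀ r, 0 ≤ r → Mρ r ≤ Real.exp (a + d * r)) {ext : ℕ → Gen ε → ℝ} (hext0 : ∀ t P, 0 ≤ ext t P)
    {C₀ c₀ : ℝ} (hC₀ : 0 ≤ C₀) (hc₀ : 0 ≤ c₀) {θ WB WM : ℝ} (hθ0 : 0 ≤ θ) (hθ1 : θ < 1) (hB : 0 ≤ WB) (hM : 0 ≤ WM)
    {G : Gen ε} {T : ℕ} (hD : Dated (PEv.step ∘ sh) true T G) (hC : Chrono (PEv.step ∘ sh) G)
    (hlaw : ∀ X ∈ joins (PEv.step ∘ sh) G, ∀ P ∈ tparts (PEv.step ∘ sh) X,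
      ext (ftime (PEv.step ∘ sh) X) P ≤ C₀ * zmass sh θ WB WM (ftime (PEv.step ∘ sh) X) P + c₀) :
    MρP (PEv.step ∘ sh) ext Mρ G ≤
      Real.exp ((a + d * c₀) * (2 * nmerges G) + d * C₀ * (umass sh WB WM G / (1 - θ))) :=
  MρP_le_exp_of_law (PEv.step ∘ sh) ext Mρ ha hd hMρ0 hMρ hext0 hC₀ hc₀ (fun t P => zmass sh θ WB WM t P) G hlaw
    (sum_joins_tparts_zmass_le hθ0 hθ1 hB hM hD hC)

/-- **THE CONSUMER'S SHAPE `MρP ≤ exp(κρ·F)`**, `F = Σ_births (fat + 1)`,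
`κρ = 2(a + d·c₀) + d·C₀·(WB + WM)∕(1 − θ)` — part 8's second class-linear input, discharged down to the extent law at
the joins in `zmass` currency, `Chrono`, `Dated` and the exponential type of `Mρ`. [folklore] -/
theorem MρP_le_exp_bsum {a d : ℝ} (ha : 0 ≤ a) (hd : 0 ≤ d) (hMρ0 : ∀ r, 0 ≤ Mρ r)
    (hMρ : ∀ r, 0 ≤ r → Mρ r ≤ Real.exp (a + d * r)) {ext : ℕ → Gen ε → ℝ} (hext0 : ∀ t P, 0 ≤ ext t P)
    {C₀ c₀ : ℝ} (hC₀ : 0 ≤ C₀) (hc₀ : 0 ≤ c₀) {θ WB WM : ℝ} (hθ0 : 0 ≤ θ) (hθ1 : θ < 1) (hB : 0 ≤ WB) (hM : 0 ≤ WM)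
    {G : Gen ε} {T : ℕ} (hD : Dated (PEv.step ∘ sh) true T G) (hC : Chrono (PEv.step ∘ sh) G)
    (hlaw : ∀ X ∈ joins (PEv.step ∘ sh) G, ∀ P ∈ tparts (PEv.step ∘ sh) X,
      ext (ftime (PEv.step ∘ sh) X) P ≤ C₀ * zmass sh θ WB WM (ftime (PEv.step ∘ sh) X) P + c₀) :
    MρP (PEv.step ∘ sh) ext Mρ G ≤
      Real.exp ((2 * (a + d * c₀) + d * C₀ * ((WB + WM) / (1 - θ))) * bsum (fun b => (((sh b).fat : ℕ) : ℝ) + 1) G) := by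
  refine (MρP_le_exp_of_zmass Mρ sh ha hd hMρ0 hMρ hext0 hC₀ hc₀ hθ0 hθ1 hB hM hD hC hlaw).trans
    (Real.exp_le_exp.2 ?_)
  set F := bsum (fun b => (((sh b).fat : ℕ) : ℝ) + 1) G
  have hn : (nmerges G : ℝ) + 1 ≤ F := nmerges_lt_bsum sh G
  have hn0 : (0 : ℝ) ≤ nmerges G := Nat.cast_nonneg _
  have hu : umass sh WB WM G = WB * F + WM * (nmerges G : ℝ) := by
    rw [umass_eq_bsum, ← bsum_mul]
  have h1θ : 0 < 1 - θ := by linarith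
  have hac : 0 ≤ a + d * c₀ := by positivity
  have hdC : 0 ≤ d * C₀ := by positivity
  have hum : umass sh WB WM G ≤ (WB + WM) * F := by rw [hu]; nlinarith
  have hdiv : umass sh WB WM G / (1 - θ) ≤ (WB + WM) / (1 - θ) * F := by
    rw [div_mul_eq_mul_div, div_le_div_iff_of_pos_right h1θ]; exact hum
  nlinarith [mul_le_mul_of_nonneg_left hdiv hdC, mul_le_mul_of_nonneg_left (show (2 : ℝ) * nmerges G ≤ 2 * F by linarith) hac]

end

end Summit.QuantumFields.BalabanUV.T4Continuum.HistoryJoinsRadius
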